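import Mathlib
import Summits.QuantumFields.YangMills.Theorems.BalabanUVNodesN15BackgroundPairSpace
import Summits.QuantumFields.YangMills.Theorems.BalabanUVNodesN15VectorCarrier
import HarnessLib

/-!
# Route «BalabanUVNodes» (cluster K4 «SpineRates»), Track-A DAG node N15 = spine estimate NE2, BACKGROUND LAYER — THE FIRST-ORDER PAIR SPACE WITH MATRIX
# (NON-ABELIAN) COEFFICIENTS: the unstacked perturbation `V̂ = M_C∘pr_none + Σ_μ M_{A_μ}∘pr_μ` by MATRIX-valued coefficients on the product carrier `X × ι`
# (`𝔤 ≅ ℝ^ι`), its diagonal max-row-sum letters, and the η-defect of the constructed NON-ABELIAN first-order background-dependent pair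

Cell `pub-ymgap`, seat `pub-ymgap-dag-n15-c` (generation g0; R134 ACCELERATION SEAT, strategy s1 — the background layer's OPERATOR ingredients; HUMAN RULING
D-0062; chair R424 venue).  `bears_on: R4∕N15`.  Filed `--supports stmt-QuantumFields-19676` (K3; helper).  Imports n15-b's part B1b `…N15.BackgroundLayer`
(`projO`, `stack`, `blkPair`, `liftPair`, `hasMaj_stack`, `hasMaj_projO_comp`, `idef_stack`; through it B1a `bgPropV`, `bgPropV_fix`, `hasMaj_idef_bgPropV`) and
n15-b's part 14 `…N15.MatrixSpecies` (`mmulOp`, `mmulOp_apply`, `liftMap`, `liftBlk`) BY NAME; nothing in the tree is modified.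

WHY (n15-b HANDOFF §g5.7 (N1), «free for n15-c (s1)»: *«MATRIX SPECIES, U LIVE NON-ABELIAN: … the scalar `unstack` replaced by a matrix `unstackM` on part 14's
product carrier `(X × ι) × Option J` … needs: `hasMaj_unstackM` (max-row-sum version of B1b `hasMaj_unstack`), `hasMaj_idef_unstackM`; then B1a∕B3∕C2 verbatim»*).
The print's first-order perturbation `V′₁(A)` ([Balaban1985BackgroundPropagators] (3.50)–(3.52) p. 400) has MATRIX coefficients — `ad_{A(b)}`, `exp(iη ad_{A(b)})`,
`F′_{1,k}(ad_{A(b)})` acting on `𝔤`-valued fields (n15-b parts 13b∕14∕18 typed them as operators with operator-norm ∕ max-row-sum letters).  Parts B1b–B4∕C1∕C2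
constructed the background-dependent pair for SCALAR coefficients only.  THIS FILE is B1b's §1∕§2 for matrix coefficients: on the product carrier `X × ι` (scalar
fields `f : X × ι → ℝ` = `𝔤 ≅ ℝ^ι`-valued fields on `X`, blocks `liftBlk blk ι`, pairing `liftMap π ι`) the unstacked perturbation
`V̂ f (x, i) = Σ_j C(x)_{ij} f((x, j), none) + Σ_μ Σ_j A_μ(x)_{ij} f((x, j), some μ)` has the DIAGONAL block majorant `diagK (r(1+|J|))` from the max-row-sum letters
`Σ_j |C(x)_{ij}|, Σ_j |A_μ(x)_{ij}| ≤ r` and the diagonal η-defect `diagK (o(1+|J|))` from the row fits — exactly B1a's perturbation letters; so B1a's rectangular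
fixed point and defect theorem apply VERBATIM and give the NON-ABELIAN first-order pair `bgPairM G D C A := bgPropV (stack G D) (unstackM C A)` with (3.65) by
construction and its η-defect from the `U ≡ 1` layer + the matrix letters.

CONTENTS ([folklore] plumbing + bookkeeping; 2 defs).
* §1 `unstackM` (`unstackM_apply`, `idef_unstackM_apply`), **`hasMaj_unstackM`** (`diagK (r(1+|J|))` from the row-sum letters), **`hasMaj_idef_unstackM`** (the
  unstacked matrix-coefficient defect through `(pull (liftPair (liftMap π ι)), pull (liftMap π ι))` is diagonal, `diagK (o(1+|J|))`, from the row fits).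
* §2 THE NON-ABELIAN FIRST-ORDER BACKGROUND-DEPENDENT PAIR `bgPairM`: `projO_none_bgPairM` (`X = G + G∘V̂∘X̂` — (3.65) for the propagator itself),
  `projO_some_bgPairM`, **`hasMaj_idef_bgPairM`** (the η-defect of the pair through `(pull (liftMap π ι), pull (liftPair (liftMap π ι)))`:
  `≤ (m c_r + m c_r·(Rβ(1−q)⁻¹) + β·O·β(1−q)⁻¹·c_r)(1−q)⁻¹·e^{−ρd}`, `R = r(1+|J|)`, `O = o(1+|J|)`, `q = βRc_r < 1`, from the `U ≡ 1` layer on the product carrier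
  (majorants `β·e^{−δd}` of `G, D_μ, G′, D′_μ`, defects `m·e^{−δd}` of `(G′,G), (D′_μ,D_μ)`) and the max-row-sum letters of ALL matrix coefficients),
  `hasMaj_idef_bgPairM_proj` (entries 0∕1 read off the components).

HONEST FRAMING ∕ LIMITS.  MECHANISM + finite-dimensional linear algebra over hypothesis-shaped data: the `U ≡ 1` layer on the product carrier and the matrix letters
are DISPLAYED (the print's species `exp(iη ad_A)`∕`Phi1` with operator-norm letters `≤ κ_e‖·‖` — parts 13b∕16∕18 — are the intended inhabitants, NOT wired in this
file: that is the sequel); linearised transport for the fits; nothing about Bałaban's `G(U)` of [B6]∕[B9] asserted.  NE2⁺ NOT PRINTED, NOT proved; count-neutral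
(typed 28∕28; nothing discharged); N15 NOT discharged; one finite lattice at fixed ε — NOT infinite volume, NOT OS on ℝ⁴, NOT a mass gap, NOT Clay.
-/

noncomputable section

open scoped BigOperators

namespace Summit.QuantumFields.YangMills.BalabanUVNodes.N15.BackgroundLayer

open Literature.MathematicalPhysics.QuantumFieldTheory.Balaban1983to89
open Literature.MathematicalPhysics.QuantumFieldTheory.Balaban1983to89.B11SectG (BlockNorm HasMaj RowSum)
open Literature.MathematicalPhysics.QuantumFieldTheory.Balaban1983to89.T4EtaRateDefect (idef idef_apply)
open Literature.MathematicalPhysics.QuantumFieldTheory.Balaban1983to89.T4EtaRateCoeffDefect (pull pull_apply diagK diagK_same diagK_ne diagK_nonneg)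
open Literature.MathematicalPhysics.QuantumFieldTheory.Balaban1983to89.B6RandomWalk (Triangle254)
open Literature.MathematicalPhysics.QuantumFieldTheory.Balaban1983to89.B11AxialTransport190 (abs_le_loc_ofBlocks loc_ofBlocks_le)
open Summit.QuantumFields.YangMills.BalabanUVNodes.N15.MatrixSpecies (mmulOp mmulOp_apply liftMap liftBlk)

/-! ## §1 The unstacked perturbation with matrix coefficients and its diagonal letters -/

section Stack

variable {X X' J ι : Type} [Fintype ι] [Fintype J]

/-- THE UNSTACKED FIRST-ORDER PERTURBATION WITH MATRIX COEFFICIENTS `V̂ f = M_C f(·, none) + Σ_μ M_{A_μ} f(·, some μ)` on `𝔤 ≅ ℝ^ι`-valued fields (part 14's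
`mmulOp` on the product carrier `X × ι`) — so that `V∘X = V̂∘(X, ∇_μX)_μ` for the non-abelian `V = M_C + Σ_μ M_{A_μ}∘∇_μ` of (3.52)'s shape.
[cite: Balaban1985BackgroundPropagators, (3.50)–(3.52) p.400 (first-order perturbation with `ad`-valued coefficients: shape)] -/
def unstackM (C : X → Matrix ι ι ℝ) (A : J → X → Matrix ι ι ℝ) : ((X × ι) × Option J → ℝ) →ₗ[ℝ] (X × ι → ℝ) :=
  mmulOp C ∘ₗ projO none + ∑ μ, mmulOp (A μ) ∘ₗ projO (some μ)

/-- Unfolding. [folklore] -/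
theorem unstackM_apply (C : X → Matrix ι ι ℝ) (A : J → X → Matrix ι ι ℝ) (f : (X × ι) × Option J → ℝ) (p : X × ι) :
    unstackM C A f p = ∑ j, C p.1 p.2 j * f ((p.1, j), none) + ∑ μ, ∑ j, A μ p.1 p.2 j * f ((p.1, j), some μ) := by
  simp [unstackM, LinearMap.sum_apply, Finset.sum_apply, mmulOp_apply]

/-- Pointwise form of the unstacked matrix-coefficient defect through `(pull (liftPair (liftMap π ι)), pull (liftMap π ι))`: multiplication by the ROW FIT ERRORS,
component by component. [folklore] -/
theorem idef_unstackM_apply (π : X' → X) (C : X → Matrix ι ι ℝ) (A : J → X → Matrix ι ι ℝ) (C' : X' → Matrix ι ι ℝ) (A' : J → X' → Matrix ι ι ℝ)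
    (f : (X × ι) × Option J → ℝ) (p : X' × ι) :
    idef (pull (liftPair (liftMap π ι))) (pull (liftMap π ι)) (unstackM C' A') (unstackM C A) f p =
      ∑ j, (C' p.1 p.2 j - C (π p.1) p.2 j) * f (((π p.1), j), none) + ∑ μ, ∑ j, (A' μ p.1 p.2 j - A μ (π p.1) p.2 j) * f (((π p.1), j), some μ) := by
  simp only [idef_apply, Pi.sub_apply, unstackM_apply, pull_apply, sub_mul, Finset.sum_sub_distrib]
  ring

variable [Fintype X] [Fintype X'] {g : B6.Geometry} (blk : X → g.Site)

/-- **THE UNSTACKED MATRIX PERTURBATION HAS THE DIAGONAL MAJORANT `diagK (r(1 + |J|))`** from the MAX-ROW-SUM letters `Σ_j |C(x)_{ij}|, Σ_j |A_μ(x)_{ij}| ≤ r`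
(B1b `hasMaj_unstack` with part 14's row-sum bookkeeping). [cite: Balaban1985BackgroundPropagators, (3.35) p.396 («|A| < O(1)Mα₀(L^jη)^{−1}»: shape)] -/
theorem hasMaj_unstackM {C : X → Matrix ι ι ℝ} {A : J → X → Matrix ι ι ℝ} {r : ℝ} (hr : 0 ≤ r) (hC : ∀ x i, ∑ j, |C x i j| ≤ r)
    (hA : ∀ μ x i, ∑ j, |A μ x i j| ≤ r) :
    HasMaj (BlockNorm.ofBlocks g (blkPair (liftBlk blk ι))) (BlockNorm.ofBlocks g (liftBlk blk ι)) (unstackM C A)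
      (diagK fun _ => r * (1 + Fintype.card J)) := by
  intro y' f hf y
  have hf' : ∀ p : (X × ι) × Option J, blk p.1.1 ≠ y' → f p = 0 := hf
  by_cases hy : y = y'
  · subst hy
    rw [diagK_same]
    set L : ℝ := (BlockNorm.ofBlocks g (blkPair (J := J) (liftBlk blk ι))).loc y f with hL_def
    have hL0 : 0 ≤ L := (BlockNorm.ofBlocks g (blkPair (J := J) (liftBlk blk ι))).loc_nonneg y f
    refine loc_ofBlocks_le (liftBlk blk ι) _ (by positivity) fun p hp => ?_
    have hx : blk p.1 = y := hp
    have hL : ∀ (j : ι) (o : Option J), |f ((p.1, j), o)| ≤ L := fun j o =>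
      abs_le_loc_ofBlocks (blkPair (liftBlk blk ι)) f (x' := ((p.1, j), o)) hx
    have hrow : ∀ (B : Matrix ι ι ℝ) (o : Option J), ∑ j, |B p.2 j| ≤ r → |∑ j, B p.2 j * f ((p.1, j), o)| ≤ r * L := fun B o hB =>
      calc |∑ j, B p.2 j * f ((p.1, j), o)| ≤ ∑ j, |B p.2 j * f ((p.1, j), o)| := Finset.abs_sum_le_sum_abs _ _
        _ = ∑ j, |B p.2 j| * |f ((p.1, j), o)| := Finset.sum_congr rfl fun j _ => abs_mul _ _
        _ ≤ ∑ j, |B p.2 j| * L := Finset.sum_le_sum fun j _ => mul_le_mul_of_nonneg_left (hL j o) (abs_nonneg _)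
        _ = (∑ j, |B p.2 j|) * L := by rw [Finset.sum_mul]
        _ ≤ r * L := mul_le_mul_of_nonneg_right hB hL0
    have h1 : |∑ j, C p.1 p.2 j * f ((p.1, j), none)| ≤ r * L := hrow (C p.1) none (hC p.1 p.2)
    have h2 : ∀ μ, |∑ j, A μ p.1 p.2 j * f ((p.1, j), some μ)| ≤ r * L := fun μ => hrow (A μ p.1) (some μ) (hA μ p.1 p.2)
    rw [unstackM_apply]
    calc |∑ j, C p.1 p.2 j * f ((p.1, j), none) + ∑ μ, ∑ j, A μ p.1 p.2 j * f ((p.1, j), some μ)|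
        ≤ |∑ j, C p.1 p.2 j * f ((p.1, j), none)| + ∑ μ, |∑ j, A μ p.1 p.2 j * f ((p.1, j), some μ)| :=
          (abs_add_le _ _).trans (add_le_add le_rfl (Finset.abs_sum_le_sum_abs _ _))
      _ ≤ r * L + ∑ _μ : J, r * L := add_le_add h1 (Finset.sum_le_sum fun μ _ => h2 μ)
      _ = r * (1 + Fintype.card J) * L := by rw [Finset.sum_const, Finset.card_univ, nsmul_eq_mul]; ring
  · rw [diagK_ne _ hy, zero_mul]
    refine loc_ofBlocks_le (liftBlk blk ι) _ le_rfl fun p hp => ?_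
    have hx : blk p.1 = y := hp
    have h0 : ∀ (j : ι) (o : Option J), f ((p.1, j), o) = 0 := fun j o => hf' ((p.1, j), o) (by rw [hx]; exact hy)
    simp [unstackM_apply, h0]

/-- **THE UNSTACKED MATRIX-COEFFICIENT DEFECT IS DIAGONAL**: `𝔇(V̂′, V̂) ≤ diagK (o(1 + |J|))` through `(pull (liftPair (liftMap π ι)), pull (liftMap π ι))` from the
ROW FITS `Σ_j |C′(x′)_{ij} − C(πx′)_{ij}|, Σ_j |A′_μ(x′)_{ij} − A_μ(πx′)_{ij}| ≤ o` (`o ≥ 0`). [folklore] -/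
theorem hasMaj_idef_unstackM (π : X' → X) {C : X → Matrix ι ι ℝ} {A : J → X → Matrix ι ι ℝ} {C' : X' → Matrix ι ι ℝ} {A' : J → X' → Matrix ι ι ℝ}
    {o : ℝ} (ho : 0 ≤ o) (hC : ∀ x' i, ∑ j, |C' x' i j - C (π x') i j| ≤ o) (hA : ∀ μ x' i, ∑ j, |A' μ x' i j - A μ (π x') i j| ≤ o) :
    HasMaj (BlockNorm.ofBlocks g (blkPair (liftBlk blk ι))) (BlockNorm.ofBlocks g (liftBlk (blk ∘ π) ι))
      (idef (pull (liftPair (liftMap π ι))) (pull (liftMap π ι)) (unstackM C' A') (unstackM C A)) (diagK fun _ => o * (1 + Fintype.card J)) := by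
  intro y' f hf y
  have hf' : ∀ p : (X × ι) × Option J, blk p.1.1 ≠ y' → f p = 0 := hf
  by_cases hy : y = y'
  · subst hy
    rw [diagK_same]
    set L : ℝ := (BlockNorm.ofBlocks g (blkPair (J := J) (liftBlk blk ι))).loc y f with hL_def
    have hL0 : 0 ≤ L := (BlockNorm.ofBlocks g (blkPair (J := J) (liftBlk blk ι))).loc_nonneg y f
    refine loc_ofBlocks_le (liftBlk (blk ∘ π) ι) _ (by positivity) fun p hp => ?_
    have hx : blk (π p.1) = y := hp
    have hL : ∀ (j : ι) (oj : Option J), |f (((π p.1), j), oj)| ≤ L := fun j oj =>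
      abs_le_loc_ofBlocks (blkPair (liftBlk blk ι)) f (x' := (((π p.1), j), oj)) hx
    have hrow : ∀ (B : Matrix ι ι ℝ) (oj : Option J), ∑ j, |B p.2 j| ≤ o → |∑ j, B p.2 j * f (((π p.1), j), oj)| ≤ o * L := fun B oj hB =>
      calc |∑ j, B p.2 j * f (((π p.1), j), oj)| ≤ ∑ j, |B p.2 j * f (((π p.1), j), oj)| := Finset.abs_sum_le_sum_abs _ _
        _ = ∑ j, |B p.2 j| * |f (((π p.1), j), oj)| := Finset.sum_congr rfl fun j _ => abs_mul _ _
        _ ≤ ∑ j, |B p.2 j| * L := Finset.sum_le_sum fun j _ => mul_le_mul_of_nonneg_left (hL j oj) (abs_nonneg _)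
        _ = (∑ j, |B p.2 j|) * L := by rw [Finset.sum_mul]
        _ ≤ o * L := mul_le_mul_of_nonneg_right hB hL0
    have h1 : |∑ j, (C' p.1 p.2 j - C (π p.1) p.2 j) * f (((π p.1), j), none)| ≤ o * L :=
      hrow (C' p.1 - C (π p.1)) none (by simpa [Matrix.sub_apply] using hC p.1 p.2)
    have h2 : ∀ μ, |∑ j, (A' μ p.1 p.2 j - A μ (π p.1) p.2 j) * f (((π p.1), j), some μ)| ≤ o * L := fun μ =>
      hrow (A' μ p.1 - A μ (π p.1)) (some μ) (by simpa [Matrix.sub_apply] using hA μ p.1 p.2)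
    rw [idef_unstackM_apply]
    calc |∑ j, (C' p.1 p.2 j - C (π p.1) p.2 j) * f (((π p.1), j), none) + ∑ μ, ∑ j, (A' μ p.1 p.2 j - A μ (π p.1) p.2 j) * f (((π p.1), j), some μ)|
        ≤ |∑ j, (C' p.1 p.2 j - C (π p.1) p.2 j) * f (((π p.1), j), none)| +
            ∑ μ, |∑ j, (A' μ p.1 p.2 j - A μ (π p.1) p.2 j) * f (((π p.1), j), some μ)| :=
          (abs_add_le _ _).trans (add_le_add le_rfl (Finset.abs_sum_le_sum_abs _ _))
      _ ≤ o * L + ∑ _μ : J, o * L := add_le_add h1 (Finset.sum_le_sum fun μ _ => h2 μ)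
      _ = o * (1 + Fintype.card J) * L := by rw [Finset.sum_const, Finset.card_univ, nsmul_eq_mul]; ring
  · rw [diagK_ne _ hy, zero_mul]
    refine loc_ofBlocks_le (liftBlk (blk ∘ π) ι) _ le_rfl fun p hp => ?_
    have hx : blk (π p.1) = y := hp
    have h0 : ∀ (j : ι) (oj : Option J), f (((π p.1), j), oj) = 0 := fun j oj => hf' (((π p.1), j), oj) (by rw [hx]; exact hy)
    simp [idef_unstackM_apply, h0]

end Stack

/-! ## §2 The non-abelian first-order background-dependent pair and its η-defect -/

section Pair

variable {X X' J ι : Type} [Fintype X] [Fintype X'] [Fintype J] [Fintype ι] [DecidableEq X] [DecidableEq X'] [DecidableEq J] [DecidableEq ι]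
  {g : B6.Geometry} (blk : X → g.Site) (π : X' → X)

/-- THE NON-ABELIAN FIRST-ORDER BACKGROUND-DEPENDENT PAIR `X̂ = (1 − Ĝ∘V̂)⁻¹Ĝ` of a `U ≡ 1` piece `G` on `𝔤 ≅ ℝ^ι`-valued fields, its derived pieces `D_μ` (= `∇_μG`)
and the MATRIX coefficients `C, A_μ` of `V = M_C + Σ_μ M_{A_μ}∘∇_μ`: component `none` = the background propagator `X(U)`, component `some μ` = `∇_μX(U)`.
[cite: Balaban1985BackgroundPropagators, (3.64) p.403 (shape); (3.50)–(3.52) p.400 (the `ad`-valued coefficients: shape)] -/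
def bgPairM (G : (X × ι → ℝ) →ₗ[ℝ] (X × ι → ℝ)) (D : J → (X × ι → ℝ) →ₗ[ℝ] (X × ι → ℝ)) (C : X → Matrix ι ι ℝ) (A : J → X → Matrix ι ι ℝ) :
    (X × ι → ℝ) →ₗ[ℝ] ((X × ι) × Option J → ℝ) :=
  bgPropV (stack G D) (unstackM C A)

variable {G : (X × ι → ℝ) →ₗ[ℝ] (X × ι → ℝ)} {D : J → (X × ι → ℝ) →ₗ[ℝ] (X × ι → ℝ)} {C : X → Matrix ι ι ℝ} {A : J → X → Matrix ι ι ℝ}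

/-- **THE PROPAGATOR COMPONENT SOLVES (3.65)**: `X = G + G∘(V̂∘X̂)` — the print's `X = G + G∘V∘X` for the non-abelian first-order `V`.
[cite: Balaban1985BackgroundPropagators, (3.65) p.403 (shape)] -/
theorem projO_none_bgPairM (hunit : IsUnit (1 - LinearMap.toMatrix' (stack G D ∘ₗ unstackM C A))) :
    projO none ∘ₗ bgPairM G D C A = G + G ∘ₗ (unstackM C A ∘ₗ bgPairM G D C A) := by
  unfold bgPairM
  conv_lhs => rw [bgPropV_fix hunit]
  rw [LinearMap.comp_add, projO_none_comp_stack]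
  rfl

/-- THE DERIVATIVE COMPONENT: `X̂_μ = D_μ + D_μ∘(V̂∘X̂)`. [cite: King1986, Prop. 3.9 (3.73) p.665 (separate derivative kernel: shape)] -/
theorem projO_some_bgPairM (hunit : IsUnit (1 - LinearMap.toMatrix' (stack G D ∘ₗ unstackM C A))) (μ : J) :
    projO (some μ) ∘ₗ bgPairM G D C A = D μ + D μ ∘ₗ (unstackM C A ∘ₗ bgPairM G D C A) := by
  unfold bgPairM
  conv_lhs => rw [bgPropV_fix hunit]
  rw [LinearMap.comp_add, projO_some_comp_stack]
  rfl

variable {G' : (X' × ι → ℝ) →ₗ[ℝ] (X' × ι → ℝ)} {D' : J → (X' × ι → ℝ) →ₗ[ℝ] (X' × ι → ℝ)} {C' : X' → Matrix ι ι ℝ} {A' : J → X' → Matrix ι ι ℝ}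

/-- **THE η-DEFECT OF THE NON-ABELIAN FIRST-ORDER BACKGROUND-DEPENDENT PAIR.**  Data: a [B6] carrier ((2.54), `d ≥ 0`, (2.61) at `σ ≥ 0` with `c_r ≥ 0`);
coarse∕fine lattices `X, X′` blocked by `blk`, `blk ∘ π` and paired by `π`, the `𝔤`-valued fields carried on `X × ι`, `X′ × ι` (blocks `liftBlk`, pairing
`liftMap π ι`); the `U ≡ 1` LAYER on the product carrier — pieces `G, G′` and derived pieces `D_μ, D′_μ` with block majorants `β·e^{−δd}`, defects
`𝔇(G′,G), 𝔇(D′_μ,D_μ) ≤ m·e^{−δd}` (`m ≥ 0` carries the rate factor); the MATRIX COEFFICIENTS of `V = M_C + Σ_μ M_{A_μ}∘∇_μ` at both spacings with the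
(3.35)-shaped max-row-sum letters `Σ_j |C(x)_{ij}|, Σ_j |A_μ(x)_{ij}|, Σ_j |C′(x′)_{ij}|, Σ_j |A′_μ(x′)_{ij}| ≤ r` and row fits `≤ o`; rate `0 ≤ ρ`, `ρ + σ ≤ δ`; smallness
`q = β·R·c_r < 1` with `R = r(1 + |J|)`.  CONCLUSION: with `O = o(1 + |J|)`,
`𝔇(X̂′, X̂) ≤ (m c_r + m c_r·(R·β(1−q)⁻¹) + β·O·β(1−q)⁻¹·c_r)(1−q)⁻¹·e^{−ρd}` through `(pull (liftMap π ι), pull (liftPair (liftMap π ι)))` — B1a's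
`hasMaj_idef_bgPropV` VERBATIM with the matrix letters of §1. [cite: Balaban1985BackgroundPropagators, (3.50)–(3.52) p.400, (3.63)–(3.65) pp.402–403 (shapes, mechanism); Balaban1984PropagatorsII, (2.52)–(2.56) pp.232–233, Lemma 2.1 (2.61) p.234] -/
theorem hasMaj_idef_bgPairM (htri : Triangle254 g) (hd : ∀ a b : g.Site, 0 ≤ g.dist a b) {σ cr : ℝ} (hσ : 0 ≤ σ) (hcr : 0 ≤ cr) (hrow : RowSum g σ cr)
    {ρ δ β r o m : ℝ} (hρ : 0 ≤ ρ) (hρδ : ρ + σ ≤ δ) (hβ : 0 ≤ β) (hr : 0 ≤ r) (ho : 0 ≤ o) (hm : 0 ≤ m)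
    (hG : HasMaj (BlockNorm.ofBlocks g (liftBlk blk ι)) (BlockNorm.ofBlocks g (liftBlk blk ι)) G (fun y y' => β * Real.exp (-(δ * g.dist y y'))))
    (hD : ∀ μ, HasMaj (BlockNorm.ofBlocks g (liftBlk blk ι)) (BlockNorm.ofBlocks g (liftBlk blk ι)) (D μ)
      (fun y y' => β * Real.exp (-(δ * g.dist y y'))))
    (hG' : HasMaj (BlockNorm.ofBlocks g (liftBlk (blk ∘ π) ι)) (BlockNorm.ofBlocks g (liftBlk (blk ∘ π) ι)) G'
      (fun y y' => β * Real.exp (-(δ * g.dist y y'))))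
    (hD' : ∀ μ, HasMaj (BlockNorm.ofBlocks g (liftBlk (blk ∘ π) ι)) (BlockNorm.ofBlocks g (liftBlk (blk ∘ π) ι)) (D' μ)
      (fun y y' => β * Real.exp (-(δ * g.dist y y'))))
    (hDG : HasMaj (BlockNorm.ofBlocks g (liftBlk blk ι)) (BlockNorm.ofBlocks g (liftBlk (blk ∘ π) ι))
      (idef (pull (liftMap π ι)) (pull (liftMap π ι)) G' G) (fun y y' => m * Real.exp (-(δ * g.dist y y'))))
    (hDD : ∀ μ, HasMaj (BlockNorm.ofBlocks g (liftBlk blk ι)) (BlockNorm.ofBlocks g (liftBlk (blk ∘ π) ι))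
      (idef (pull (liftMap π ι)) (pull (liftMap π ι)) (D' μ) (D μ)) (fun y y' => m * Real.exp (-(δ * g.dist y y'))))
    (hC : ∀ x i, ∑ j, |C x i j| ≤ r) (hA : ∀ μ x i, ∑ j, |A μ x i j| ≤ r) (hC' : ∀ x' i, ∑ j, |C' x' i j| ≤ r) (hA' : ∀ μ x' i, ∑ j, |A' μ x' i j| ≤ r)
    (hfC : ∀ x' i, ∑ j, |C' x' i j - C (π x') i j| ≤ o) (hfA : ∀ μ x' i, ∑ j, |A' μ x' i j - A μ (π x') i j| ≤ o)
    (hq : β * (r * (1 + Fintype.card J)) * cr < 1) :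
    HasMaj (BlockNorm.ofBlocks g (liftBlk blk ι)) (BlockNorm.ofBlocks g (blkPair (liftBlk (blk ∘ π) ι)))
      (idef (pull (liftMap π ι)) (pull (liftPair (liftMap π ι))) (bgPairM G' D' C' A') (bgPairM G D C A))
      (fun y y' => (m * cr + 1 * (m * cr) * (r * (1 + Fintype.card J) * (β * (1 - β * (r * (1 + Fintype.card J)) * cr)⁻¹)) +
          β * (o * (1 + Fintype.card J)) * (β * (1 - β * (r * (1 + Fintype.card J)) * cr)⁻¹) * cr) *
        (1 - 1 * (β * (r * (1 + Fintype.card J)) * cr))⁻¹ * Real.exp (-(ρ * g.dist y y'))) := by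
  have hβe : ∀ y y' : g.Site, 0 ≤ β * Real.exp (-(δ * g.dist y y')) := fun _ _ => mul_nonneg hβ (Real.exp_nonneg _)
  have hme : ∀ y y' : g.Site, 0 ≤ m * Real.exp (-(δ * g.dist y y')) := fun _ _ => mul_nonneg hm (Real.exp_nonneg _)
  have hJ : (0 : ℝ) ≤ 1 + Fintype.card J := by positivity
  -- the U ≡ 1 layer, stacked on the product carrier
  have hSG := hasMaj_stack (liftBlk blk ι) hβe hG hD
  have hSG' := hasMaj_stack (liftBlk (blk ∘ π) ι) hβe hG' hD'
  have hSD : HasMaj (BlockNorm.ofBlocks g (liftBlk blk ι)) (BlockNorm.ofBlocks g (blkPair (liftBlk (blk ∘ π) ι)))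
      (idef (pull (liftMap π ι)) (pull (liftPair (liftMap π ι))) (stack G' D') (stack G D)) (fun y y' => m * Real.exp (-(δ * g.dist y y'))) := by
    rw [idef_stack]
    exact hasMaj_stack (liftBlk (blk ∘ π) ι) hme hDG hDD
  -- the matrix perturbation letters, unstacked
  have hV := hasMaj_unstackM blk hr hC hA
  have hV' := hasMaj_unstackM (blk ∘ π) hr hC' hA'
  have hDV := hasMaj_idef_unstackM blk π ho hfC hfA
  exact hasMaj_idef_bgPropV (liftBlk blk ι) (blkPair (liftBlk blk ι)) (liftMap π ι) (liftPair (liftMap π ι)) htri hd hσ hcr hrow hρ hρδ hβ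
    (mul_nonneg hr hJ) (mul_nonneg ho hJ) hm hSG hSG' hSD hV hV' hDV hq

/-- **ENTRIES 0∕1 OF THE NON-ABELIAN FIRST-ORDER BACKGROUND-DEPENDENT PAIR** (the propagator component `j = none`, the `∇_μ`-component `j = some μ`): each inherits
the pair's majorant. [cite: Balaban1985BackgroundPropagators, Thm 3.1 (3.42) p.397 (first two entries: shape)] -/
theorem hasMaj_idef_bgPairM_proj (htri : Triangle254 g) (hd : ∀ a b : g.Site, 0 ≤ g.dist a b) {σ cr : ℝ} (hσ : 0 ≤ σ) (hcr : 0 ≤ cr) (hrow : RowSum g σ cr)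
    {ρ δ β r o m : ℝ} (hρ : 0 ≤ ρ) (hρδ : ρ + σ ≤ δ) (hβ : 0 ≤ β) (hr : 0 ≤ r) (ho : 0 ≤ o) (hm : 0 ≤ m)
    (hG : HasMaj (BlockNorm.ofBlocks g (liftBlk blk ι)) (BlockNorm.ofBlocks g (liftBlk blk ι)) G (fun y y' => β * Real.exp (-(δ * g.dist y y'))))
    (hD : ∀ μ, HasMaj (BlockNorm.ofBlocks g (liftBlk blk ι)) (BlockNorm.ofBlocks g (liftBlk blk ι)) (D μ)
      (fun y y' => β * Real.exp (-(δ * g.dist y y'))))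
    (hG' : HasMaj (BlockNorm.ofBlocks g (liftBlk (blk ∘ π) ι)) (BlockNorm.ofBlocks g (liftBlk (blk ∘ π) ι)) G'
      (fun y y' => β * Real.exp (-(δ * g.dist y y'))))
    (hD' : ∀ μ, HasMaj (BlockNorm.ofBlocks g (liftBlk (blk ∘ π) ι)) (BlockNorm.ofBlocks g (liftBlk (blk ∘ π) ι)) (D' μ)
      (fun y y' => β * Real.exp (-(δ * g.dist y y'))))
    (hDG : HasMaj (BlockNorm.ofBlocks g (liftBlk blk ι)) (BlockNorm.ofBlocks g (liftBlk (blk ∘ π) ι))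
      (idef (pull (liftMap π ι)) (pull (liftMap π ι)) G' G) (fun y y' => m * Real.exp (-(δ * g.dist y y'))))
    (hDD : ∀ μ, HasMaj (BlockNorm.ofBlocks g (liftBlk blk ι)) (BlockNorm.ofBlocks g (liftBlk (blk ∘ π) ι))
      (idef (pull (liftMap π ι)) (pull (liftMap π ι)) (D' μ) (D μ)) (fun y y' => m * Real.exp (-(δ * g.dist y y'))))
    (hC : ∀ x i, ∑ j, |C x i j| ≤ r) (hA : ∀ μ x i, ∑ j, |A μ x i j| ≤ r) (hC' : ∀ x' i, ∑ j, |C' x' i j| ≤ r) (hA' : ∀ μ x' i, ∑ j, |A' μ x' i j| ≤ r)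
    (hfC : ∀ x' i, ∑ j, |C' x' i j - C (π x') i j| ≤ o) (hfA : ∀ μ x' i, ∑ j, |A' μ x' i j - A μ (π x') i j| ≤ o)
    (hq : β * (r * (1 + Fintype.card J)) * cr < 1) (j : Option J) :
    HasMaj (BlockNorm.ofBlocks g (liftBlk blk ι)) (BlockNorm.ofBlocks g (liftBlk (blk ∘ π) ι))
      (idef (pull (liftMap π ι)) (pull (liftMap π ι)) (projO j ∘ₗ bgPairM G' D' C' A') (projO j ∘ₗ bgPairM G D C A))
      (fun y y' => (m * cr + 1 * (m * cr) * (r * (1 + Fintype.card J) * (β * (1 - β * (r * (1 + Fintype.card J)) * cr)⁻¹)) +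
          β * (o * (1 + Fintype.card J)) * (β * (1 - β * (r * (1 + Fintype.card J)) * cr)⁻¹) * cr) *
        (1 - 1 * (β * (r * (1 + Fintype.card J)) * cr))⁻¹ * Real.exp (-(ρ * g.dist y y'))) := by
  have key := hasMaj_idef_bgPairM blk π htri hd hσ hcr hrow hρ hρδ hβ hr ho hm hG hD hG' hD' hDG hDD hC hA hC' hA' hfC hfA hq
  have hcomp : idef (pull (liftMap π ι)) (pull (liftMap π ι)) (projO j ∘ₗ bgPairM G' D' C' A') (projO j ∘ₗ bgPairM G D C A) =
      projO j ∘ₗ idef (pull (liftMap π ι)) (pull (liftPair (liftMap π ι))) (bgPairM G' D' C' A') (bgPairM G D C A) :=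
    LinearMap.ext fun v => funext fun x' => rfl
  rw [hcomp]
  exact hasMaj_projO_comp (liftBlk (blk ∘ π) ι) key j

end Pair

end Summit.QuantumFields.YangMills.BalabanUVNodes.N15.BackgroundLayer
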